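import Literature.Probability.RandomPlanarGeometry.ObliqueRBMWedgeHalfPlane
import HarnessLib

/-!
# Boundary values of the half-plane primitive `Φ`

Layer of the proof of
`Literature.Probability.RandomPlanarGeometry.LawlerSchrammWerner2001_orbm_uniformHitting`
(`ObliqueRBMWedge.lean`). For the primitive `Φ = TestIntervals.phi` of
`ObliqueRBMWedgeHalfPlane.lean`:

* `exists_vertexBound` — at EVERY real point `p` the kernel satisfies `‖Φ'(w)‖ ≤ C‖w − p‖^{-1/3}`
  nearby (power singularity at the vertices `0, 1`, logarithmic at the interval endpoints,
  bounded elsewhere), hence (`exists_tendsto_phi_real`) `Φ` has a limit at `p` from `ℍ`;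
* `phiExt` — the continuous extension of `Φ` to the closed half-plane (`continuousOn_phiExt`),
  with the limit `Φ(∞)` at infinity (`norm_phiExt_sub_phiInf_le`);
* `hasDerivAt_phiExt_real` — along the real axis, at regular points, `d/dx Φₑ(x) = Φ'(x)`;
* `phiExt_sub_phiExt_eq_integral` — the **trace identity** on `(0,1)`:
  `Φₑ(u₂) − Φₑ(u₁) = ∫_{u₁}^{u₂} (π ρ̃ m + i ρ̃ gRe)` (dominated convergence from height `ε`), and
  its real part `re_phiExt_eq` on `[0, 1]`;
* `integral_phiKernel_Iic` — the **apex identity** `∫_{-∞}^0 Φ'(x) dx = Φₑ(0) − Φ(∞)`.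

## References

* L. V. Ahlfors, *Complex Analysis* (1979), Ch. 4; J. Dubédat, Ann. IHP 40 (2004), §4. [Dubedat2004]
-/

noncomputable section

open Set Filter Topology Complex MeasureTheory intervalIntegral Metric
open scoped Real Interval
open UpperHalfPlane (upperHalfPlaneSet isOpen_upperHalfPlaneSet)

namespace Literature.Probability.RandomPlanarGeometry

/-! ### Elementary logarithm bounds -/

/-- `|log t| ≤ 3 t^{-1/3}` for `0 < t ≤ 1`. [folklore] -/
theorem abs_log_le_three_mul_rpow {t : ℝ} (ht : 0 < t) (ht1 : t ≤ 1) : |Real.log t| ≤ 3 * t ^ (-(1 / 3 : ℝ)) := by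
  have h := Real.abs_log_mul_self_rpow_lt t (1 / 3) ht ht1 (by norm_num)
  rw [abs_mul, abs_of_pos (Real.rpow_pos_of_pos ht _)] at h
  have hpos : 0 < t ^ (1 / 3 : ℝ) := Real.rpow_pos_of_pos ht _
  have : |Real.log t| ≤ (1 / (1 / 3)) / t ^ (1 / 3 : ℝ) := by
    rw [le_div_iff₀ hpos]; exact h.le
  refine this.trans (le_of_eq ?_)
  rw [Real.rpow_neg ht.le]; ring

/-- `|log b| ≤ |log a| + log 2` for `0 < a ≤ b ≤ 2`. [folklore] -/
theorem abs_log_le_abs_log_add {a b : ℝ} (ha : 0 < a) (hab : a ≤ b) (hb : b ≤ 2) :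
    |Real.log b| ≤ |Real.log a| + Real.log 2 := by
  have hlog2 : 0 ≤ Real.log 2 := Real.log_nonneg (by norm_num)
  by_cases h1 : 1 ≤ b
  · rw [abs_of_nonneg (Real.log_nonneg h1)]
    exact (Real.log_le_log (by linarith) hb).trans (by linarith [abs_nonneg (Real.log a)])
  · rw [not_le] at h1
    rw [abs_of_neg (Real.log_neg (ha.trans_le hab) h1)]
    have : Real.log a ≤ Real.log b := Real.log_le_log ha hab
    have : -Real.log b ≤ |Real.log a| := by
      have := neg_abs_le (Real.log a); linarith
    linarith

/-- Near a real point `p`, `|log ‖w − e‖| ≤ L ‖w − p‖^{-1/3}` (`e` real; the logarithmic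
singularity if `e = p`, a bounded quantity otherwise). [folklore] -/
theorem exists_abs_log_norm_sub_le (e p : ℝ) : ∃ r > 0, ∃ L, 0 ≤ L ∧
    ∀ w : ℂ, 0 < ‖w - p‖ → ‖w - p‖ ≤ r → |Real.log ‖w - e‖| ≤ L * ‖w - p‖ ^ (-(1 / 3 : ℝ)) := by
  by_cases hep : e = p
  · subst hep
    refine ⟨1, one_pos, 3, by norm_num, fun w hw hw1 ↦ abs_log_le_three_mul_rpow hw hw1⟩
  · set d : ℝ := |p - e| with hd
    have hd0 : 0 < d := abs_pos.2 (sub_ne_zero.2 (Ne.symm hep))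
    set r : ℝ := min (d / 2) 1 with hr
    have hr0 : 0 < r := lt_min (by linarith) one_pos
    -- on the ball, `‖w - e‖ ∈ [d/2, d + 1]`
    set L : ℝ := (|Real.log (d / 2)| + |Real.log (d + 1)|) * r ^ (1 / 3 : ℝ) with hL
    refine ⟨r, hr0, L, by positivity, fun w hw hwr ↦ ?_⟩
    have hlow : d / 2 ≤ ‖w - e‖ := by
      have h1 : ‖(p : ℂ) - e‖ = d := by
        rw [show (p : ℂ) - e = ((p - e : ℝ) : ℂ) by push_cast; ring, Complex.norm_real, Real.norm_eq_abs]
      have h2 : ‖(p : ℂ) - e‖ ≤ ‖(p : ℂ) - w‖ + ‖w - e‖ := norm_sub_le_norm_sub_add_norm_sub _ _ _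
      rw [norm_sub_rev (p : ℂ) w] at h2
      have h3 : r ≤ d / 2 := min_le_left _ _
      linarith
    have hup : ‖w - e‖ ≤ d + 1 := by
      have h1 : ‖(p : ℂ) - e‖ = d := by
        rw [show (p : ℂ) - e = ((p - e : ℝ) : ℂ) by push_cast; ring, Complex.norm_real, Real.norm_eq_abs]
      have h2 : ‖w - (e : ℂ)‖ ≤ ‖w - p‖ + ‖(p : ℂ) - e‖ := norm_sub_le_norm_sub_add_norm_sub _ _ _
      have h3 : r ≤ 1 := min_le_right _ _
      linarith
    have hwe : 0 < ‖w - e‖ := by linarith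
    -- `|log ‖w-e‖| ≤ |log (d/2)| + |log (d+1)|`
    have hlog : |Real.log ‖w - e‖| ≤ |Real.log (d / 2)| + |Real.log (d + 1)| := by
      have h1 : Real.log (d / 2) ≤ Real.log ‖w - e‖ := Real.log_le_log (by linarith) hlow
      have h2 : Real.log ‖w - e‖ ≤ Real.log (d + 1) := Real.log_le_log hwe hup
      rw [abs_le]
      constructor
      · linarith [neg_abs_le (Real.log (d / 2)), abs_nonneg (Real.log (d + 1))]
      · linarith [le_abs_self (Real.log (d + 1)), abs_nonneg (Real.log (d / 2))]
    -- `1 ≤ r^{1/3} ‖w-p‖^{-1/3}`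
    have hone : 1 ≤ r ^ (1 / 3 : ℝ) * ‖w - p‖ ^ (-(1 / 3 : ℝ)) := by
      have h1 : r ^ (-(1 / 3 : ℝ)) ≤ ‖w - (p : ℂ)‖ ^ (-(1 / 3 : ℝ)) :=
        Real.rpow_le_rpow_of_nonpos hw hwr (by norm_num)
      have h2 : r ^ (1 / 3 : ℝ) * r ^ (-(1 / 3 : ℝ)) = 1 := by
        rw [← Real.rpow_add hr0]; norm_num
      calc (1:ℝ) = r ^ (1 / 3 : ℝ) * r ^ (-(1 / 3 : ℝ)) := h2.symm
        _ ≤ r ^ (1 / 3 : ℝ) * ‖w - (p : ℂ)‖ ^ (-(1 / 3 : ℝ)) := by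
            gcongr
    calc |Real.log ‖w - e‖| ≤ (|Real.log (d / 2)| + |Real.log (d + 1)|) * 1 := by rw [mul_one]; exact hlog
      _ ≤ (|Real.log (d / 2)| + |Real.log (d + 1)|) * (r ^ (1 / 3 : ℝ) * ‖w - p‖ ^ (-(1 / 3 : ℝ))) := by
          gcongr
      _ = L * ‖w - p‖ ^ (-(1 / 3 : ℝ)) := by rw [hL]; ring

/-- A bounded quantity is `≤ B r^{1/3} ‖w − p‖^{-1/3}` on the punctured ball of radius `r`.
[folklore] -/
theorem le_mul_rpow_of_le {B r : ℝ} {p : ℝ} {w : ℂ} (hB : 0 ≤ B) (hr : 0 < r) (hw : 0 < ‖w - p‖)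
    (hwr : ‖w - p‖ ≤ r) {q : ℝ} (hq : q ≤ B) : q ≤ B * r ^ (1 / 3 : ℝ) * ‖w - p‖ ^ (-(1 / 3 : ℝ)) := by
  have h1 : r ^ (-(1 / 3 : ℝ)) ≤ ‖w - (p : ℂ)‖ ^ (-(1 / 3 : ℝ)) :=
    Real.rpow_le_rpow_of_nonpos hw hwr (by norm_num)
  have h2 : r ^ (1 / 3 : ℝ) * r ^ (-(1 / 3 : ℝ)) = 1 := by rw [← Real.rpow_add hr]; norm_num
  calc q ≤ B * 1 := by rw [mul_one]; exact hq
    _ = B * (r ^ (1 / 3 : ℝ) * r ^ (-(1 / 3 : ℝ))) := by rw [h2]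
    _ ≤ B * (r ^ (1 / 3 : ℝ) * ‖w - (p : ℂ)‖ ^ (-(1 / 3 : ℝ))) := by gcongr
    _ = _ := by ring

/-- The general norm bound for the log-ratio (valid off the two endpoints only). [folklore] -/
theorem norm_logRatio_le' {a b : ℝ} {w : ℂ} (ha : w ≠ a) (hb : w ≠ b) :
    ‖logRatio a b w‖ ≤ |Real.log ‖w - a‖| + |Real.log ‖w - b‖| + π := by
  have ha' : w - a ≠ 0 := sub_ne_zero.2 ha
  have hb' : w - b ≠ 0 := sub_ne_zero.2 hb
  rw [logRatio]
  calc ‖log ((w - a) / (w - b))‖ ≤ |(log ((w - a) / (w - b))).re| + |(log ((w - a) / (w - b))).im| :=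
        Complex.norm_le_abs_re_add_abs_im _
    _ ≤ (|Real.log ‖w - a‖| + |Real.log ‖w - b‖|) + π := by
        refine add_le_add ?_ ?_
        · rw [Complex.log_re, norm_div, Real.log_div (norm_ne_zero_iff.2 ha') (norm_ne_zero_iff.2 hb')]
          exact abs_sub _ _
        · rw [Complex.log_im]; exact abs_arg_le_pi _
    _ = _ := by ring

namespace TestIntervals

variable (D : TestIntervals)

/-- **Norm bound for `g` off the real endpoints.** [folklore] -/
theorem norm_g_le_logs {w : ℂ} (hw : w.im ≠ 0) :
    ‖D.g w‖ ≤ (|Real.log ‖w - D.α‖| + |Real.log ‖w - D.β‖| + π) / (D.β - D.α)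
      + (|Real.log ‖w - D.γ‖| + |Real.log ‖w - D.δ‖| + π) / (D.δ - D.γ) := by
  have hne : ∀ c : ℝ, w ≠ c := fun c h ↦ by rw [h] at hw; simp at hw
  have hba : 0 < D.β - D.α := by linarith [D.hαβ]
  have hdg : 0 < D.δ - D.γ := by linarith [D.hγδ]
  unfold g
  refine (norm_sub_le _ _).trans (add_le_add ?_ ?_)
  · rw [norm_div, show ((D.β : ℂ) - D.α) = ((D.β - D.α : ℝ) : ℂ) by push_cast; ring, Complex.norm_real,
      Real.norm_eq_abs, abs_of_pos hba]
    exact div_le_div_of_nonneg_right (norm_logRatio_le' (hne _) (hne _)) hba.le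
  · rw [norm_div, show ((D.δ : ℂ) - D.γ) = ((D.δ - D.γ : ℝ) : ℂ) by push_cast; ring, Complex.norm_real,
      Real.norm_eq_abs, abs_of_pos hdg]
    exact div_le_div_of_nonneg_right (norm_logRatio_le' (hne _) (hne _)) hdg.le

/-- **`g` grows at most like `‖w − p‖^{-1/3}` near any real point** (from `ℍ`). [folklore] -/
theorem exists_norm_g_le (p : ℝ) : ∃ r > 0, ∃ L, 0 ≤ L ∧
    ∀ w : ℂ, 0 < w.im → ‖w - p‖ ≤ r → ‖D.g w‖ ≤ L * ‖w - p‖ ^ (-(1 / 3 : ℝ)) := by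
  obtain ⟨r₁, hr₁, L₁, hL₁, h₁⟩ := exists_abs_log_norm_sub_le D.α p
  obtain ⟨r₂, hr₂, L₂, hL₂, h₂⟩ := exists_abs_log_norm_sub_le D.β p
  obtain ⟨r₃, hr₃, L₃, hL₃, h₃⟩ := exists_abs_log_norm_sub_le D.γ p
  obtain ⟨r₄, hr₄, L₄, hL₄, h₄⟩ := exists_abs_log_norm_sub_le D.δ p
  have hba : 0 < D.β - D.α := by linarith [D.hαβ]
  have hdg : 0 < D.δ - D.γ := by linarith [D.hγδ]
  set r : ℝ := min (min (min r₁ r₂) (min r₃ r₄)) 1 with hr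
  have hr0 : 0 < r := lt_min (lt_min (lt_min hr₁ hr₂) (lt_min hr₃ hr₄)) one_pos
  have hrle₁ : r ≤ r₁ := (min_le_left _ _).trans ((min_le_left _ _).trans (min_le_left _ _))
  have hrle₂ : r ≤ r₂ := (min_le_left _ _).trans ((min_le_left _ _).trans (min_le_right _ _))
  have hrle₃ : r ≤ r₃ := (min_le_left _ _).trans ((min_le_right _ _).trans (min_le_left _ _))
  have hrle₄ : r ≤ r₄ := (min_le_left _ _).trans ((min_le_right _ _).trans (min_le_right _ _))
  set Lπ : ℝ := π * r ^ (1 / 3 : ℝ) with hLπ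
  refine ⟨r, hr0, (L₁ + L₂ + Lπ) / (D.β - D.α) + (L₃ + L₄ + Lπ) / (D.δ - D.γ), by positivity,
    fun w hw hwr ↦ ?_⟩
  have hwp : 0 < ‖w - p‖ := by
    rw [norm_pos_iff]; intro h0
    have : (w - (p : ℂ)).im = 0 := by rw [h0]; rfl
    simp at this; linarith
  have hπ : π ≤ Lπ * ‖w - p‖ ^ (-(1 / 3 : ℝ)) := by
    have := le_mul_rpow_of_le Real.pi_pos.le hr0 hwp hwr (le_refl π)
    rw [hLπ]; exact this
  have e1 := h₁ w hwp (hwr.trans hrle₁)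
  have e2 := h₂ w hwp (hwr.trans hrle₂)
  have e3 := h₃ w hwp (hwr.trans hrle₃)
  have e4 := h₄ w hwp (hwr.trans hrle₄)
  refine (D.norm_g_le_logs hw.ne').trans ?_
  have hρ : 0 ≤ ‖w - (p : ℂ)‖ ^ (-(1 / 3 : ℝ)) := Real.rpow_nonneg (norm_nonneg _) _
  calc (|Real.log ‖w - D.α‖| + |Real.log ‖w - D.β‖| + π) / (D.β - D.α)
        + (|Real.log ‖w - D.γ‖| + |Real.log ‖w - D.δ‖| + π) / (D.δ - D.γ)
      ≤ (L₁ * ‖w - p‖ ^ (-(1 / 3 : ℝ)) + L₂ * ‖w - p‖ ^ (-(1 / 3 : ℝ)) + Lπ * ‖w - p‖ ^ (-(1 / 3 : ℝ))) / (D.β - D.α)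
        + (L₃ * ‖w - p‖ ^ (-(1 / 3 : ℝ)) + L₄ * ‖w - p‖ ^ (-(1 / 3 : ℝ)) + Lπ * ‖w - p‖ ^ (-(1 / 3 : ℝ))) / (D.δ - D.γ) := by
        gcongr
    _ = ((L₁ + L₂ + Lπ) / (D.β - D.α) + (L₃ + L₄ + Lπ) / (D.δ - D.γ)) * ‖w - p‖ ^ (-(1 / 3 : ℝ)) := by
        field_simp

/-- **Vertex bound at every real point**: `‖Φ'(w)‖ ≤ C ‖w − p‖^{-1/3}` on `ℍ` near `p`. [folklore] -/
theorem exists_vertexBound (p : ℝ) : ∃ r > 0, ∃ C, 0 ≤ C ∧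
    ∀ w : ℂ, 0 < w.im → ‖w - p‖ ≤ r → ‖D.phiKernel w‖ ≤ C * ‖w - p‖ ^ (-(1 / 3 : ℝ)) := by
  by_cases hp0 : p = 0
  · subst hp0
    obtain ⟨C, hC, h⟩ := D.exists_vertexBound_zero
    exact ⟨D.rz, D.rz_pos, C, hC, fun w hw hwr ↦ by simpa using h w hw (by simpa using hwr)⟩
  by_cases hp1 : p = 1
  · subst hp1
    obtain ⟨C, hC, h⟩ := D.exists_vertexBound_one
    exact ⟨D.ro, D.ro_pos, C, hC, fun w hw hwr ↦ by simpa using h w hw (by simpa using hwr)⟩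
  -- generic point: `P`, `Q` bounded, `g` log-bounded
  obtain ⟨r₁, hr₁, L, hL, hg⟩ := D.exists_norm_g_le p
  set d₀ : ℝ := |p| / 2 with hd₀
  set d₁ : ℝ := |p - 1| / 2 with hd₁
  have hd₀pos : 0 < d₀ := by rw [hd₀]; exact half_pos (abs_pos.2 hp0)
  have hd₁pos : 0 < d₁ := by rw [hd₁]; exact half_pos (abs_pos.2 (sub_ne_zero.2 hp1))
  set r : ℝ := min r₁ (min d₀ d₁) with hr
  have hr0 : 0 < r := lt_min hr₁ (lt_min hd₀pos hd₁pos)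
  refine ⟨r, hr0, d₀ ^ (-(1 / 3 : ℝ)) * d₁ ^ (-(1 / 3 : ℝ)) * L, by positivity, fun w hw hwr ↦ ?_⟩
  have hw0 : w ≠ 0 := by rintro rfl; simp at hw
  have hw1 : w ≠ 1 := by rintro rfl; simp at hw
  have hwr₁ : ‖w - p‖ ≤ r₁ := hwr.trans (min_le_left _ _)
  have hwd₀ : ‖w - p‖ ≤ d₀ := hwr.trans ((min_le_right _ _).trans (min_le_left _ _))
  have hwd₁ : ‖w - p‖ ≤ d₁ := hwr.trans ((min_le_right _ _).trans (min_le_right _ _))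
  -- `‖w‖ ≥ d₀`, `‖1 - w‖ ≥ d₁`
  have hP : ‖w‖ ^ (-(1 / 3 : ℝ)) ≤ d₀ ^ (-(1 / 3 : ℝ)) := by
    apply Real.rpow_le_rpow_of_nonpos hd₀pos _ (by norm_num)
    have h1 : ‖(p : ℂ)‖ ≤ ‖(p : ℂ) - w‖ + ‖w‖ := norm_le_norm_sub_add _ _
    rw [Complex.norm_real, Real.norm_eq_abs, norm_sub_rev] at h1
    linarith
  have hQ : ‖1 - w‖ ^ (-(1 / 3 : ℝ)) ≤ d₁ ^ (-(1 / 3 : ℝ)) := by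
    apply Real.rpow_le_rpow_of_nonpos hd₁pos _ (by norm_num)
    have h1 : ‖(p : ℂ) - 1‖ ≤ ‖(p : ℂ) - w‖ + ‖w - 1‖ := norm_sub_le_norm_sub_add_norm_sub _ _ _
    rw [show (p : ℂ) - 1 = ((p - 1 : ℝ) : ℂ) by push_cast; ring, Complex.norm_real, Real.norm_eq_abs,
      norm_sub_rev (p : ℂ) w, norm_sub_rev w 1] at h1
    linarith
  rw [D.norm_phiKernel hw0 hw1]
  have hgw := hg w hw hwr₁
  calc ‖w‖ ^ (-(1 / 3 : ℝ)) * ‖1 - w‖ ^ (-(1 / 3 : ℝ)) * ‖D.g w‖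
      ≤ d₀ ^ (-(1 / 3 : ℝ)) * d₁ ^ (-(1 / 3 : ℝ)) * (L * ‖w - p‖ ^ (-(1 / 3 : ℝ))) :=
        mul_le_mul (mul_le_mul hP hQ (Real.rpow_nonneg (norm_nonneg _) _) (Real.rpow_nonneg hd₀pos.le _))
          hgw (norm_nonneg _) (mul_nonneg (Real.rpow_nonneg hd₀pos.le _) (Real.rpow_nonneg hd₁pos.le _))
    _ = _ := by ring

/-- **`Φ` has a limit at every real point from `ℍ`**, with the rate `‖Φ(w) − V‖ ≤ K ‖w−p‖^{2/3}`.
[folklore] -/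
theorem exists_tendsto_phi_real (p : ℝ) : ∃ V : ℂ, ∃ r > 0, ∃ K, 0 ≤ K ∧
    (∀ w : ℂ, 0 < w.im → ‖w - p‖ ≤ r → ‖D.phi w - V‖ ≤ K * ‖w - p‖ ^ (2 / 3 : ℝ)) ∧
      Tendsto D.phi (𝓝[upperHalfPlaneSet] (p : ℂ)) (𝓝 V) := by
  obtain ⟨r, hr, C, hC, hB⟩ := D.exists_vertexBound p
  refine ⟨D.vertexVal p r, r / 3, by positivity, 7 * C, by positivity,
    fun w hw hwr ↦ D.norm_phi_sub_vertexVal_le hr hC hB hw hwr, ?_⟩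
  rw [tendsto_iff_norm_sub_tendsto_zero]
  have hlim : Tendsto (fun w : ℂ ↦ 7 * C * ‖w - p‖ ^ (2 / 3 : ℝ)) (𝓝[upperHalfPlaneSet] (p : ℂ)) (𝓝 0) := by
    have : Tendsto (fun w : ℂ ↦ 7 * C * ‖w - p‖ ^ (2 / 3 : ℝ)) (𝓝 (p : ℂ)) (𝓝 (7 * C * ‖(p : ℂ) - p‖ ^ (2 / 3 : ℝ))) := by
      refine (tendsto_const_nhds.mul ?_)
      exact ((continuous_id.sub continuous_const).norm.rpow_const fun _ ↦ Or.inr (by norm_num)).continuousAt.tendsto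
    rw [sub_self, norm_zero, Real.zero_rpow (by norm_num), mul_zero] at this
    exact this.mono_left nhdsWithin_le_nhds
  refine squeeze_zero_norm' ?_ hlim
  have hmem : {w : ℂ | ‖w - p‖ < r / 3} ∈ 𝓝[upperHalfPlaneSet] (p : ℂ) := by
    apply mem_nhdsWithin_of_mem_nhds
    have : {w : ℂ | ‖w - p‖ < r / 3} = ball (p : ℂ) (r / 3) := by ext w; simp [dist_eq_norm]
    rw [this]; exact ball_mem_nhds _ (by positivity)
  filter_upwards [hmem, self_mem_nhdsWithin] with w hw hw'
  rw [norm_norm]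
  exact D.norm_phi_sub_vertexVal_le hr hC hB hw' hw.le

/-! ### The continuous extension to the closed half-plane -/

/-- **The boundary extension** `Φₑ` of `Φ` to `{im ≥ 0}` by limits. [folklore] -/
def phiExt : ℂ → ℂ := extendFrom upperHalfPlaneSet D.phi

/-- Auxiliary statement (`phiExt_eq`). [folklore] -/
theorem phiExt_eq {w : ℂ} (hw : 0 < w.im) : D.phiExt w = D.phi w :=
  extendFrom_extends D.continuousOn_phi w hw

/-- Auxiliary statement (`tendsto_phi_phiExt_real`). [folklore] -/
theorem tendsto_phi_phiExt_real (p : ℝ) : Tendsto D.phi (𝓝[upperHalfPlaneSet] (p : ℂ)) (𝓝 (D.phiExt p)) := by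
  obtain ⟨V, r, hr, K, hK, _, hV⟩ := D.exists_tendsto_phi_real p
  rwa [phiExt, extendFrom_eq (mem_closure_upperHalfPlaneSet_iff.2 (by simp)) hV]

/-- The rate at a real point, for the extension: `‖Φ(w) − Φₑ(p)‖ ≤ K‖w − p‖^{2/3}`. [folklore] -/
theorem exists_rate_phiExt_real (p : ℝ) : ∃ r > 0, ∃ K, 0 ≤ K ∧
    ∀ w : ℂ, 0 < w.im → ‖w - p‖ ≤ r → ‖D.phi w - D.phiExt p‖ ≤ K * ‖w - p‖ ^ (2 / 3 : ℝ) := by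
  obtain ⟨V, r, hr, K, hK, hrate, hV⟩ := D.exists_tendsto_phi_real p
  have : D.phiExt p = V := extendFrom_eq (mem_closure_upperHalfPlaneSet_iff.2 (by simp)) hV
  exact ⟨r, hr, K, hK, fun w hw hwr ↦ by rw [this]; exact hrate w hw hwr⟩

/-- `Φ` has a limit within `ℍ` at every point of the closed half-plane. [folklore] -/
theorem exists_tendsto_phi_of_im_nonneg {x : ℂ} (hx : 0 ≤ x.im) :
    ∃ y, Tendsto D.phi (𝓝[upperHalfPlaneSet] x) (𝓝 y) := by
  rcases hx.lt_or_eq with hx | hx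
  · exact ⟨D.phi x, D.continuousOn_phi x hx⟩
  · have : ((x.re : ℝ) : ℂ) = x := Complex.ext (by simp) (by simp [← hx])
    rw [← this]
    obtain ⟨V, r, hr, K, hK, _, hV⟩ := D.exists_tendsto_phi_real x.re
    exact ⟨V, hV⟩

/-- **`Φₑ` is continuous on the closed half-plane.** [folklore] -/
theorem continuousOn_phiExt : ContinuousOn D.phiExt {z : ℂ | 0 ≤ z.im} :=
  continuousOn_extendFrom (fun _ hz ↦ mem_closure_upperHalfPlaneSet_iff.2 hz)
    fun _ hx ↦ D.exists_tendsto_phi_of_im_nonneg hx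

/-- Auxiliary statement (`continuous_phiExt_ofReal`). [folklore] -/
theorem continuous_phiExt_ofReal : Continuous fun x : ℝ ↦ D.phiExt x :=
  D.continuousOn_phiExt.comp_continuous continuous_ofReal fun x ↦ by simp

/-- **The limit at infinity for the extension**: `‖Φₑ(w) − Φ(∞)‖ ≤ 33/‖w‖` on `{im ≥ 0}`,
`‖w‖ > 4`. [folklore] -/
theorem norm_phiExt_sub_phiInf_le {w : ℂ} (hw : 0 ≤ w.im) (hw4 : 4 < ‖w‖) :
    ‖D.phiExt w - D.phiInf‖ ≤ 33 / ‖w‖ := by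
  rcases hw.lt_or_eq with hw' | hw'
  · rw [D.phiExt_eq hw']; exact D.norm_phi_sub_phiInf_le hw' hw4.le
  · have hx : ((w.re : ℝ) : ℂ) = w := Complex.ext (by simp) (by simp [← hw'])
    have hlim := D.tendsto_phi_phiExt_real w.re
    rw [hx] at hlim
    haveI hne : (𝓝[upperHalfPlaneSet] w).NeBot :=
      mem_closure_iff_nhdsWithin_neBot.1 (mem_closure_upperHalfPlaneSet_iff.2 hw)
    have h1 : Tendsto (fun z ↦ ‖D.phi z - D.phiInf‖) (𝓝[upperHalfPlaneSet] w) (𝓝 ‖D.phiExt w - D.phiInf‖) :=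
      (hlim.sub_const _).norm
    have h2 : Tendsto (fun z : ℂ ↦ 33 / ‖z‖) (𝓝[upperHalfPlaneSet] w) (𝓝 (33 / ‖w‖)) := by
      refine (tendsto_const_nhds.div continuous_norm.continuousAt.tendsto ?_).mono_left nhdsWithin_le_nhds
      linarith
    refine le_of_tendsto_of_tendsto h1 h2 ?_
    have hopen : IsOpen {z : ℂ | 4 < ‖z‖} := isOpen_lt continuous_const continuous_norm
    filter_upwards [self_mem_nhdsWithin, mem_nhdsWithin_of_mem_nhds (hopen.mem_nhds hw4)] with z hz hz4
    exact D.norm_phi_sub_phiInf_le hz (le_of_lt hz4)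

/-! ### Real differentiability of the extension at regular points -/

/-- Near a regular real point the extension coincides with the local primitive. [folklore] -/
theorem phiExt_eq_near {p : ℝ} (hp : (p : ℂ) ∈ D.kernelDomain) :
    ∃ ε > 0, ∃ Ψ : ℂ → ℂ, (∀ z ∈ ball (p : ℂ) ε, HasDerivAt Ψ (D.phiKernel z) z) ∧
      ∀ x : ℝ, |x - p| < ε → D.phiExt x = Ψ x := by
  obtain ⟨ε, hε, Ψ, hΨ, hΦΨ⟩ := D.exists_primitive_near hp
  refine ⟨ε, hε, Ψ, hΨ, fun x hx ↦ ?_⟩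
  have hxball : (x : ℂ) ∈ ball (p : ℂ) ε := by
    rw [mem_ball, dist_eq_norm, show (x : ℂ) - p = ((x - p : ℝ) : ℂ) by push_cast; ring, Complex.norm_real,
      Real.norm_eq_abs]; exact hx
  have hlim := D.tendsto_phi_phiExt_real x
  haveI hne : (𝓝[upperHalfPlaneSet] (x : ℂ)).NeBot :=
    mem_closure_iff_nhdsWithin_neBot.1 (mem_closure_upperHalfPlaneSet_iff.2 (by simp))
  have hΨlim : Tendsto Ψ (𝓝[upperHalfPlaneSet] (x : ℂ)) (𝓝 (Ψ x)) :=
    ((hΨ x hxball).continuousAt.tendsto).mono_left nhdsWithin_le_nhds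
  have heq : D.phi =ᶠ[𝓝[upperHalfPlaneSet] (x : ℂ)] Ψ := by
    filter_upwards [self_mem_nhdsWithin, mem_nhdsWithin_of_mem_nhds (isOpen_ball.mem_nhds hxball)] with z hz hzb
    exact hΦΨ z hzb hz
  exact tendsto_nhds_unique hlim (hΨlim.congr' heq.symm)

/-- **Along the real axis, at regular points, `Φₑ` is differentiable with derivative `Φ'`.**
[folklore] -/
theorem hasDerivAt_phiExt_real {p : ℝ} (hp : (p : ℂ) ∈ D.kernelDomain) :
    HasDerivAt (fun x : ℝ ↦ D.phiExt x) (D.phiKernel p) p := by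
  obtain ⟨ε, hε, Ψ, hΨ, heq⟩ := D.phiExt_eq_near hp
  have h1 : HasDerivAt (fun x : ℝ ↦ Ψ x) (D.phiKernel p) p := (hΨ p (mem_ball_self hε)).comp_ofReal
  refine h1.congr_of_eventuallyEq ?_
  filter_upwards [Metric.ball_mem_nhds p hε] with x hx
  exact heq x (by rwa [mem_ball, Real.dist_eq] at hx)

/-! ### The trace identity on `(0, 1)` -/

/-- The vertical approach `ε ↦ u + iε` tends to `u` within `ℍ` as `ε ↓ 0`. [folklore] -/
theorem tendsto_vertical_approach (u : ℝ) :
    Tendsto (fun ε : ℝ ↦ (u : ℂ) + ε * I) (𝓝[>] 0) (𝓝[upperHalfPlaneSet] (u : ℂ)) := by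
  refine tendsto_nhdsWithin_iff.2 ⟨?_, ?_⟩
  · have : Continuous fun ε : ℝ ↦ (u : ℂ) + ε * I := by fun_prop
    have h := this.continuousAt (x := 0) |>.tendsto
    simp only [ofReal_zero, zero_mul, add_zero] at h
    exact h.mono_left nhdsWithin_le_nhds
  · filter_upwards [self_mem_nhdsWithin] with ε hε
    show 0 < ((u : ℂ) + ε * I).im
    simpa using hε

/-- The boundary kernel on `(0,1)`: `π ρ̃ m + i ρ̃ gRe`. [folklore] -/
def bdryKernel (x : ℝ) : ℂ := ((π * rhoTilde x * D.m x : ℝ) : ℂ) + I * ((rhoTilde x * D.gRe x : ℝ) : ℂ)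

/-- The dominating function for the kernels at height `ε ∈ (0, 1]` over `[u₁, u₂] ⊂ (0,1)`.
[folklore] -/
def domBound (u₁ u₂ x : ℝ) : ℝ :=
  u₁ ^ (-(1 / 3 : ℝ)) * (1 - u₂) ^ (-(1 / 3 : ℝ)) *
    ((|Real.log (x - D.α)| + |Real.log (x - D.β)| + 2 * Real.log 2 + π) / (D.β - D.α)
      + (|Real.log (x - D.γ)| + |Real.log (x - D.δ)| + 2 * Real.log 2 + π) / (D.δ - D.γ))

/-- Auxiliary statement (`intervalIntegrable_abs_log_sub`). [folklore] -/
theorem intervalIntegrable_abs_log_sub (e a b : ℝ) :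
    IntervalIntegrable (fun x : ℝ ↦ |Real.log (x - e)|) volume a b := by
  have h := (intervalIntegral.intervalIntegrable_log' (a := a - e) (b := b - e)).comp_sub_right e
  simp only [sub_add_cancel] at h
  exact h.abs

/-- Auxiliary statement (`intervalIntegrable_domBound`). [folklore] -/
theorem intervalIntegrable_domBound (u₁ u₂ a b : ℝ) : IntervalIntegrable (D.domBound u₁ u₂) volume a b := by
  unfold domBound
  refine IntervalIntegrable.const_mul ?_ _
  refine IntervalIntegrable.add ?_ ?_
  · refine IntervalIntegrable.div_const ?_ _
    exact (((intervalIntegrable_abs_log_sub D.α a b).add (intervalIntegrable_abs_log_sub D.β a b)).add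
      intervalIntegrable_const).add intervalIntegrable_const
  · refine IntervalIntegrable.div_const ?_ _
    exact (((intervalIntegrable_abs_log_sub D.γ a b).add (intervalIntegrable_abs_log_sub D.δ a b)).add
      intervalIntegrable_const).add intervalIntegrable_const

/-- `|log ‖(x − e) + iε‖| ≤ |log |x − e|| + log 2` for `x ≠ e` in `[0,1]`, `e ∈ [0,1]`, `ε ∈ (0,1]`.
[folklore] -/
theorem abs_log_norm_horiz_le {x e ε : ℝ} (hxe : x ≠ e) (hx : x ∈ Icc (0:ℝ) 1) (he : e ∈ Icc (0:ℝ) 1)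
    (hε : ε ∈ Ioc (0:ℝ) 1) : |Real.log ‖((x : ℂ) + ε * I) - e‖| ≤ |Real.log (x - e)| + Real.log 2 := by
  have hform : ((x : ℂ) + ε * I) - e = ((x - e : ℝ) : ℂ) + ε * I := by push_cast; ring
  rw [hform, ← Real.log_abs (x - e)]
  have hpos : 0 < |x - e| := abs_pos.2 (sub_ne_zero.2 hxe)
  have hlow : |x - e| ≤ ‖((x - e : ℝ) : ℂ) + ε * I‖ := by
    have := abs_re_le_norm (((x - e : ℝ) : ℂ) + ε * I)
    simpa using this
  have hup : ‖((x - e : ℝ) : ℂ) + ε * I‖ ≤ 2 := by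
    refine (norm_add_le _ _).trans ?_
    rw [Complex.norm_real, Real.norm_eq_abs, norm_mul, Complex.norm_I, mul_one, Complex.norm_real, Real.norm_eq_abs,
      abs_of_pos hε.1]
    have : |x - e| ≤ 1 := by rw [abs_le]; constructor <;> linarith [hx.1, hx.2, he.1, he.2]
    linarith [hε.2]
  exact abs_log_le_abs_log_add hpos hlow hup

/-- **Domination**: for `ε ∈ (0,1]` and `x ∈ [u₁,u₂] ⊂ (0,1)` off the endpoints,
`‖Φ'(x + iε)‖ ≤ domBound x`. [folklore] -/
theorem norm_phiKernel_horiz_le {u₁ u₂ : ℝ} (hu₁ : 0 < u₁) (hu₂ : u₂ < 1) {x : ℝ} (hx : x ∈ Icc u₁ u₂)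
    (hxe : x ∉ D.endpoints) {ε : ℝ} (hε : ε ∈ Ioc (0:ℝ) 1) :
    ‖D.phiKernel (x + ε * I)‖ ≤ D.domBound u₁ u₂ x := by
  simp only [endpoints, mem_insert_iff, mem_singleton_iff, not_or] at hxe
  obtain ⟨hxα, hxβ, hxγ, hxδ⟩ := hxe
  set w : ℂ := (x : ℂ) + ε * I with hw
  have hwim : w.im = ε := by simp [hw]
  have hw0 : w ≠ 0 := by intro h; have := congrArg Complex.im h; rw [hwim] at this; simp at this; linarith [hε.1]
  have hw1 : w ≠ 1 := by intro h; have := congrArg Complex.im h; rw [hwim] at this; simp at this; linarith [hε.1]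
  have hx01 : x ∈ Icc (0:ℝ) 1 := ⟨hu₁.le.trans hx.1, hx.2.trans hu₂.le⟩
  have hα01 : D.α ∈ Icc (0:ℝ) 1 := ⟨D.hα.le, (D.hαβ.trans D.hβ).le⟩
  have hβ01 : D.β ∈ Icc (0:ℝ) 1 := ⟨(D.hα.trans D.hαβ).le, D.hβ.le⟩
  have hγ01 : D.γ ∈ Icc (0:ℝ) 1 := ⟨D.hγ.le, (D.hγδ.trans D.hδ).le⟩
  have hδ01 : D.δ ∈ Icc (0:ℝ) 1 := ⟨(D.hγ.trans D.hγδ).le, D.hδ.le⟩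
  -- the power factors
  have hP : ‖w‖ ^ (-(1 / 3 : ℝ)) ≤ u₁ ^ (-(1 / 3 : ℝ)) := by
    apply Real.rpow_le_rpow_of_nonpos hu₁ _ (by norm_num)
    have := abs_re_le_norm w
    simp only [hw, add_re, ofReal_re, mul_re, I_re, mul_zero, ofReal_im, I_im, mul_one, sub_self, add_zero] at this
    rw [abs_of_nonneg (hu₁.le.trans hx.1)] at this
    exact hx.1.trans this
  have hQ : ‖1 - w‖ ^ (-(1 / 3 : ℝ)) ≤ (1 - u₂) ^ (-(1 / 3 : ℝ)) := by
    apply Real.rpow_le_rpow_of_nonpos (by linarith) _ (by norm_num)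
    have := abs_re_le_norm (1 - w)
    simp only [hw, sub_re, one_re, add_re, ofReal_re, mul_re, I_re, mul_zero, ofReal_im, I_im, mul_one, sub_self,
      add_zero] at this
    rw [abs_of_nonneg (by linarith [hx.2])] at this
    linarith [hx.2]
  -- the log factors
  have hg := D.norm_g_le_logs (w := w) (by rw [hwim]; exact hε.1.ne')
  have lα := abs_log_norm_horiz_le hxα hx01 hα01 hε
  have lβ := abs_log_norm_horiz_le hxβ hx01 hβ01 hε
  have lγ := abs_log_norm_horiz_le hxγ hx01 hγ01 hε
  have lδ := abs_log_norm_horiz_le hxδ hx01 hδ01 hε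
  have hba : 0 < D.β - D.α := by linarith [D.hαβ]
  have hdg : 0 < D.δ - D.γ := by linarith [D.hγδ]
  have hg' : ‖D.g w‖ ≤ (|Real.log (x - D.α)| + |Real.log (x - D.β)| + 2 * Real.log 2 + π) / (D.β - D.α)
      + (|Real.log (x - D.γ)| + |Real.log (x - D.δ)| + 2 * Real.log 2 + π) / (D.δ - D.γ) := by
    refine hg.trans (add_le_add ?_ ?_)
    · apply div_le_div_of_nonneg_right _ hba.le; rw [hw] at *; linarith
    · apply div_le_div_of_nonneg_right _ hdg.le; rw [hw] at *; linarith
  rw [D.norm_phiKernel hw0 hw1, domBound]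
  have hlog2 : 0 ≤ Real.log 2 := Real.log_nonneg (by norm_num)
  apply mul_le_mul (mul_le_mul hP hQ (Real.rpow_nonneg (norm_nonneg _) _) (Real.rpow_nonneg hu₁.le _)) hg'
    (norm_nonneg _)
  exact mul_nonneg (Real.rpow_nonneg hu₁.le _) (Real.rpow_nonneg (by linarith) _)

/-- **The trace identity on `(0,1)`** (complex form):
`Φₑ(u₂) − Φₑ(u₁) = ∫_{u₁}^{u₂} (π ρ̃ m + i ρ̃ gRe)` for `0 < u₁ ≤ u₂ < 1`. [folklore] -/
theorem phiExt_sub_phiExt_eq_integral {u₁ u₂ : ℝ} (hu₁ : 0 < u₁) (hu₂ : u₂ < 1) (h12 : u₁ ≤ u₂) :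
    D.phiExt u₂ - D.phiExt u₁ = ∫ x in u₁..u₂, D.bdryKernel x := by
  -- both sides are limits of `Φ(u₂ + iε) - Φ(u₁ + iε) = ∫ Φ'(x + iε)` as `ε ↓ 0`
  have hleft : Tendsto (fun ε : ℝ ↦ D.phi (u₂ + ε * I) - D.phi (u₁ + ε * I)) (𝓝[>] 0)
      (𝓝 (D.phiExt u₂ - D.phiExt u₁)) :=
    ((D.tendsto_phi_phiExt_real u₂).comp (tendsto_vertical_approach u₂)).sub
      ((D.tendsto_phi_phiExt_real u₁).comp (tendsto_vertical_approach u₁))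
  have heq : (fun ε : ℝ ↦ D.phi (u₂ + ε * I) - D.phi (u₁ + ε * I)) =ᶠ[𝓝[>] 0]
      fun ε ↦ ∫ x in u₁..u₂, D.phiKernel (x + ε * I) := by
    filter_upwards [self_mem_nhdsWithin] with ε hε
    exact D.phi_horiz u₁ u₂ hε
  have hright : Tendsto (fun ε : ℝ ↦ ∫ x in u₁..u₂, D.phiKernel (x + ε * I)) (𝓝[>] 0)
      (𝓝 (∫ x in u₁..u₂, D.bdryKernel x)) := by
    refine intervalIntegral.tendsto_integral_filter_of_dominated_convergence (D.domBound u₁ u₂) ?_ ?_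
      (D.intervalIntegrable_domBound u₁ u₂ u₁ u₂) ?_
    · filter_upwards [self_mem_nhdsWithin] with ε hε
      exact (D.continuous_phiKernel_horiz hε).aestronglyMeasurable
    · filter_upwards [Ioc_mem_nhdsGT (zero_lt_one' ℝ)] with ε hε
      filter_upwards [D.endpoints_finite.countable.ae_notMem volume] with x hxe hx
      rw [uIoc_of_le h12] at hx
      exact D.norm_phiKernel_horiz_le hu₁ hu₂ ⟨hx.1.le, hx.2⟩ hxe hε
    · filter_upwards [D.endpoints_finite.countable.ae_notMem volume] with x hxe hx
      rw [uIoc_of_le h12] at hx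
      have hx01 : x ∈ Ioo (0:ℝ) 1 := ⟨hu₁.trans hx.1, lt_of_le_of_lt hx.2 hu₂⟩
      have := (D.tendsto_phiKernel_real hx01 hxe).comp (tendsto_vertical_approach x)
      exact this
  exact tendsto_nhds_unique hleft (hright.congr' heq.symm)

/-- `|log(|x − a| / |x − b|)| ≤ |log |x − a|| + |log |x − b||` (all real `x`; junk-safe).
[folklore] -/
theorem abs_log_div_abs_le (x a b : ℝ) :
    |Real.log (|x - a| / |x - b|)| ≤ |Real.log (x - a)| + |Real.log (x - b)| := by
  by_cases ha : x - a = 0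
  · rw [ha]; simp
  by_cases hb : x - b = 0
  · rw [hb]; simp
  rw [Real.log_div (abs_ne_zero.2 ha) (abs_ne_zero.2 hb), Real.log_abs, Real.log_abs]
  exact abs_sub _ _

/-- Auxiliary statement (`abs_gRe_le`). [folklore] -/
theorem abs_gRe_le (x : ℝ) : |D.gRe x| ≤ (|Real.log (x - D.α)| + |Real.log (x - D.β)|) / (D.β - D.α)
    + (|Real.log (x - D.γ)| + |Real.log (x - D.δ)|) / (D.δ - D.γ) := by
  have hba : 0 < D.β - D.α := by linarith [D.hαβ]
  have hdg : 0 < D.δ - D.γ := by linarith [D.hγδ]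
  unfold gRe
  refine (abs_sub _ _).trans (add_le_add ?_ ?_)
  · rw [abs_div, abs_of_pos hba]; exact div_le_div_of_nonneg_right (abs_log_div_abs_le _ _ _) hba.le
  · rw [abs_div, abs_of_pos hdg]; exact div_le_div_of_nonneg_right (abs_log_div_abs_le _ _ _) hdg.le

/-- Auxiliary statement (`measurable_gRe`). [folklore] -/
theorem measurable_gRe : Measurable D.gRe := by
  unfold gRe
  fun_prop

/-- Auxiliary statement (`measurable_m`). [folklore] -/
theorem measurable_m : Measurable D.m := by
  unfold m
  exact ((measurable_const.indicator measurableSet_Ioo).sub (measurable_const.indicator measurableSet_Ioo))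

/-- Auxiliary statement (`abs_m_le`). [folklore] -/
theorem abs_m_le (x : ℝ) : |D.m x| ≤ 1 / (D.β - D.α) + 1 / (D.δ - D.γ) := by
  have hba : 0 < D.β - D.α := by linarith [D.hαβ]
  have hdg : 0 < D.δ - D.γ := by linarith [D.hγδ]
  unfold m
  refine (abs_sub _ _).trans (add_le_add ?_ ?_)
  · by_cases h : x ∈ Ioo D.α D.β
    · rw [indicator_of_mem h, abs_of_pos (by positivity)]
    · rw [indicator_of_notMem h, abs_zero]; positivity
  · by_cases h : x ∈ Ioo D.γ D.δ
    · rw [indicator_of_mem h, abs_of_pos (by positivity)]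
    · rw [indicator_of_notMem h, abs_zero]; positivity

/-- `m` vanishes outside `[min α γ, max β δ]`. [folklore] -/
theorem m_eq_zero_of_not_mem {x : ℝ} (hx : x ≤ min D.α D.γ ∨ max D.β D.δ ≤ x) : D.m x = 0 := by
  unfold m
  have h1 : x ∉ Ioo D.α D.β := by
    rintro ⟨h1, h2⟩
    rcases hx with h | h
    · linarith [min_le_left D.α D.γ]
    · linarith [le_max_left D.β D.δ]
  have h2 : x ∉ Ioo D.γ D.δ := by
    rintro ⟨h1, h2⟩
    rcases hx with h | h
    · linarith [min_le_right D.α D.γ]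
    · linarith [le_max_right D.β D.δ]
  rw [indicator_of_notMem h1, indicator_of_notMem h2, sub_zero]

/-- `ρ̃` is continuous on `(0, 1)`. [folklore] -/
theorem continuousOn_rhoTilde : ContinuousOn rhoTilde (Ioo 0 1) := by
  intro x hx
  unfold rhoTilde
  exact ((continuousAt_id.rpow_const (Or.inl hx.1.ne')).mul
    ((continuousAt_const.sub continuousAt_id).rpow_const (Or.inl (by linarith [hx.2] : (1:ℝ) - x ≠ 0)))).continuousWithinAt

/-- **Integrability of the real trace density** `π ρ̃ m` on any interval (it is bounded with
compact support in `(0,1)`). [folklore] -/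
theorem intervalIntegrable_traceDensity (a b : ℝ) :
    IntervalIntegrable (fun x ↦ π * rhoTilde x * D.m x) volume a b := by
  -- bounded by a constant, measurable
  set lo := min D.α D.γ with hlo
  set hi := max D.β D.δ with hhi
  have hlo0 : 0 < lo := lt_min D.hα D.hγ
  have hhi1 : hi < 1 := max_lt D.hβ D.hδ
  have hlohi : lo ≤ hi := (min_le_left _ _).trans (D.hαβ.le.trans (le_max_left _ _))
  obtain ⟨R, hR⟩ := (isCompact_Icc (a := lo) (b := hi)).exists_bound_of_continuousOn
    (continuousOn_rhoTilde.mono fun x hx ↦ ⟨hlo0.trans_le hx.1, lt_of_le_of_lt hx.2 hhi1⟩)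
  have hmeas : Measurable fun x ↦ π * rhoTilde x * D.m x := by
    unfold rhoTilde
    exact (measurable_const.mul (by fun_prop)).mul D.measurable_m
  refine (intervalIntegrable_const (c := π * max R 0 * (1 / (D.β - D.α) + 1 / (D.δ - D.γ)))).mono_fun'
    hmeas.aestronglyMeasurable (ae_of_all _ fun x ↦ ?_)
  show ‖π * rhoTilde x * D.m x‖ ≤ π * max R 0 * (1 / (D.β - D.α) + 1 / (D.δ - D.γ))
  rw [Real.norm_eq_abs]
  by_cases hx : x ∈ Icc lo hi
  · rw [abs_mul, abs_mul, abs_of_pos Real.pi_pos]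
    have h1 : |rhoTilde x| ≤ max R 0 := ((Real.norm_eq_abs _).symm.le.trans (hR x hx)).trans (le_max_left _ _)
    have hba : 0 < D.β - D.α := by linarith [D.hαβ]
    have hdg : 0 < D.δ - D.γ := by linarith [D.hγδ]
    exact mul_le_mul (mul_le_mul_of_nonneg_left h1 Real.pi_pos.le) (D.abs_m_le x) (abs_nonneg _)
      (mul_nonneg Real.pi_pos.le (le_max_right _ _))
  · have : D.m x = 0 := by
      apply D.m_eq_zero_of_not_mem
      simp only [mem_Icc, not_and_or, not_le] at hx
      rcases hx with h | h
      · exact Or.inl h.le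
      · exact Or.inr h.le
    rw [this, mul_zero, abs_zero]
    have hba : 0 < D.β - D.α := by linarith [D.hαβ]
    have hdg : 0 < D.δ - D.γ := by linarith [D.hγδ]
    positivity

/-- Auxiliary statement (`intervalIntegrable_ofReal`). [folklore] -/
theorem intervalIntegrable_ofReal {f : ℝ → ℝ} {a b : ℝ} (h : IntervalIntegrable f volume a b) :
    IntervalIntegrable (fun x ↦ (f x : ℂ)) volume a b := ⟨h.1.ofReal, h.2.ofReal⟩

/-- Auxiliary statement (`intervalIntegrable_bdryKernel`). [folklore] -/
theorem intervalIntegrable_bdryKernel {u₁ u₂ : ℝ} (hu₁ : 0 < u₁) (hu₂ : u₂ < 1) (h12 : u₁ ≤ u₂) :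
    IntervalIntegrable D.bdryKernel volume u₁ u₂ := by
  unfold bdryKernel
  refine IntervalIntegrable.add ?_ ?_
  · exact intervalIntegrable_ofReal (D.intervalIntegrable_traceDensity u₁ u₂)
  · refine IntervalIntegrable.const_mul ?_ _
    refine intervalIntegrable_ofReal ?_
    -- `ρ̃ gRe`: `ρ̃` continuous on `[u₁,u₂]`, `gRe` log-integrable
    have hρ : ContinuousOn rhoTilde (uIcc u₁ u₂) := by
      rw [uIcc_of_le h12]
      exact continuousOn_rhoTilde.mono fun x hx ↦ ⟨hu₁.trans_le hx.1, lt_of_le_of_lt hx.2 hu₂⟩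
    have hgRe : IntervalIntegrable D.gRe volume u₁ u₂ := by
      have hdom : IntervalIntegrable (fun x ↦ (|Real.log (x - D.α)| + |Real.log (x - D.β)|) / (D.β - D.α)
          + (|Real.log (x - D.γ)| + |Real.log (x - D.δ)|) / (D.δ - D.γ)) volume u₁ u₂ :=
        (((intervalIntegrable_abs_log_sub D.α u₁ u₂).add (intervalIntegrable_abs_log_sub D.β u₁ u₂)).div_const
          _).add (((intervalIntegrable_abs_log_sub D.γ u₁ u₂).add (intervalIntegrable_abs_log_sub D.δ u₁ u₂)).div_const _)
      refine hdom.mono_fun' D.measurable_gRe.aestronglyMeasurable (ae_of_all _ fun x ↦ ?_)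
      show ‖D.gRe x‖ ≤ _
      rw [Real.norm_eq_abs]; exact D.abs_gRe_le x
    exact hgRe.continuousOn_mul hρ

/-- **The trace identity, real form**: for `0 < u₁ ≤ u₂ < 1`,
`Re Φₑ(u₂) − Re Φₑ(u₁) = ∫_{u₁}^{u₂} π ρ̃ m`. [folklore] -/
theorem re_phiExt_sub {u₁ u₂ : ℝ} (hu₁ : 0 < u₁) (hu₂ : u₂ < 1) (h12 : u₁ ≤ u₂) :
    (D.phiExt u₂).re - (D.phiExt u₁).re = ∫ x in u₁..u₂, π * rhoTilde x * D.m x := by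
  have h := congrArg Complex.re (D.phiExt_sub_phiExt_eq_integral hu₁ hu₂ h12)
  rw [sub_re] at h
  rw [h]
  have hint := D.intervalIntegrable_bdryKernel hu₁ hu₂ h12
  have := Complex.reCLM.intervalIntegral_comp_comm hint
  simp only [Complex.reCLM_apply] at this
  rw [← this]
  refine intervalIntegral.integral_congr fun x _ ↦ ?_
  simp [bdryKernel]

/-- **The trace identity on the closed interval**: for `u ∈ [0, 1]`,
`Re Φₑ(u) = Re Φₑ(rz) + ∫_{rz}^{u} π ρ̃ m` (extension to the endpoints by continuity). [folklore] -/
theorem re_phiExt_eq {u : ℝ} (hu : u ∈ Icc (0:ℝ) 1) :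
    (D.phiExt u).re = (D.phiExt D.rz).re + ∫ x in D.rz..u, π * rhoTilde x * D.m x := by
  have hrz0 := D.rz_pos
  have hrz1 : D.rz < 1 := by linarith [D.rz_le_half]
  -- on the open interval
  have hopen : EqOn (fun u : ℝ ↦ (D.phiExt u).re) (fun u ↦ (D.phiExt D.rz).re + ∫ x in D.rz..u, π * rhoTilde x * D.m x)
      (Ioo 0 1) := by
    intro v hv
    simp only
    rcases le_total D.rz v with h | h
    · have := D.re_phiExt_sub hrz0 hv.2 h
      linarith
    · have := D.re_phiExt_sub hv.1 hrz1 h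
      rw [intervalIntegral.integral_symm]
      linarith
  have hcl : EqOn (fun u : ℝ ↦ (D.phiExt u).re) (fun u ↦ (D.phiExt D.rz).re + ∫ x in D.rz..u, π * rhoTilde x * D.m x)
      (Icc 0 1) := by
    refine hopen.of_subset_closure ?_ ?_ Ioo_subset_Icc_self (by rw [closure_Ioo zero_ne_one])
    · exact (Complex.continuous_re.comp D.continuous_phiExt_ofReal).continuousOn
    · refine (continuousOn_const.add ?_)
      have := intervalIntegral.continuousOn_primitive_interval' (D.intervalIntegrable_traceDensity 0 1)
        (show D.rz ∈ uIcc (0:ℝ) 1 by rw [uIcc_of_le zero_le_one]; exact ⟨hrz0.le, hrz1.le⟩)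
      rwa [uIcc_of_le zero_le_one] at this
  exact hcl hu

/-! ### The apex identity: the integral of the kernel over `(−∞, 0]` -/

/-- **Kernel bound near the vertex `0` without the half-plane restriction.** [folklore] -/
theorem exists_bound_near_zero : ∃ C, 0 ≤ C ∧
    ∀ w : ℂ, w ≠ 0 → ‖w‖ ≤ D.rz → ‖D.phiKernel w‖ ≤ C * ‖w‖ ^ (-(1 / 3 : ℝ)) := by
  obtain ⟨G, hG⟩ := (isCompact_closedBall (0:ℂ) D.rz).exists_bound_of_continuousOn
    (D.continuousOn_g.mono D.closedBall_zero_subset_gDomain)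
  refine ⟨2 * max G 0, by positivity, fun w hw0 hwr ↦ ?_⟩
  have hrz := D.rz_le_half
  have hw1 : w ≠ 1 := by rintro rfl; simp at hwr; linarith
  have h1w : 1 / 2 ≤ ‖1 - w‖ := by
    have := norm_sub_norm_le 1 w; rw [norm_one] at this; linarith
  rw [D.norm_phiKernel hw0 hw1]
  have hg : ‖D.g w‖ ≤ max G 0 := (hG w (by rw [mem_closedBall, dist_zero_right]; exact hwr)).trans (le_max_left _ _)
  have hQ := rpow_neg_third_le_two h1w
  have hP : 0 ≤ ‖w‖ ^ (-(1 / 3 : ℝ)) := Real.rpow_nonneg (norm_nonneg _) _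
  calc ‖w‖ ^ (-(1 / 3 : ℝ)) * ‖1 - w‖ ^ (-(1 / 3 : ℝ)) * ‖D.g w‖ ≤ ‖w‖ ^ (-(1 / 3 : ℝ)) * 2 * max G 0 := by
        rw [mul_assoc, mul_assoc]
        exact mul_le_mul_of_nonneg_left (mul_le_mul hQ hg (norm_nonneg _) (by norm_num)) hP
    _ = 2 * max G 0 * ‖w‖ ^ (-(1 / 3 : ℝ)) := by ring

/-- Transfer of integrability on `(−∞, c]` from the reflected function on `[−c, ∞)`. [folklore] -/
theorem integrableOn_Iic_of_comp_neg {f : ℝ → ℂ} {c : ℝ} (h : IntegrableOn (fun x ↦ f (-x)) (Ici (-c))) :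
    IntegrableOn f (Iic c) := by
  rw [← Measure.map_neg_eq_self (volume : Measure ℝ)]
  let m : MeasurableEmbedding fun x : ℝ => -x := (Homeomorph.neg ℝ).measurableEmbedding
  rw [m.integrableOn_map_iff]
  simp_rw [Function.comp_def, neg_preimage, Set.neg_Iic]
  exact h

/-- **Integrability of `Φ'` on the negative real axis.** [folklore] -/
theorem integrableOn_phiKernel_Iic : IntegrableOn (fun x : ℝ ↦ D.phiKernel x) (Iic 0) := by
  have hrz := D.rz_pos
  -- continuity on `(−∞, 0)`
  have hcont : ContinuousOn (fun x : ℝ ↦ D.phiKernel x) (Iio 0) := fun x hx ↦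
    ((D.continuousAt_phiKernel (D.ofReal_mem_kernelDomain_of_neg hx)).comp continuous_ofReal.continuousAt).continuousWithinAt
  -- (i) the tail `(−∞, −4]`
  have htail : IntegrableOn (fun x : ℝ ↦ D.phiKernel x) (Iic (-4)) := by
    apply integrableOn_Iic_of_comp_neg
    rw [neg_neg]
    have hg : IntegrableOn (fun y : ℝ ↦ 12 * y ^ (-(2:ℝ))) (Ioi 4) :=
      ((integrableOn_Ioi_rpow_of_lt (by norm_num) (by norm_num)).const_mul 12)
    rw [integrableOn_Ici_iff_integrableOn_Ioi]
    refine hg.mono' ?_ ?_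
    · refine ContinuousOn.aestronglyMeasurable ?_ measurableSet_Ioi
      exact (hcont.comp continuous_neg.continuousOn fun y hy ↦ by simp only [mem_Iio]; linarith [mem_Ioi.1 hy])
    · refine (ae_restrict_iff' measurableSet_Ioi).2 (ae_of_all _ fun y hy ↦ ?_)
      have hy4 : 4 < y := hy
      have hnorm : ‖((-y : ℝ) : ℂ)‖ = y := by rw [Complex.norm_real, Real.norm_eq_abs, abs_neg, abs_of_pos (by linarith)]
      have := D.norm_phiKernel_le (w := ((-y : ℝ) : ℂ)) (by rw [hnorm]; exact hy4.le)
      rw [hnorm] at this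
      refine this.trans (le_of_eq ?_)
      rw [Real.rpow_neg (by linarith), Real.rpow_two, div_eq_mul_inv]
  -- (ii) the middle `[−4, −rz]`
  have hmid : IntegrableOn (fun x : ℝ ↦ D.phiKernel x) (Icc (-4) (-D.rz)) :=
    (hcont.mono fun x hx ↦ by simp only [mem_Iio]; linarith [hx.2]).integrableOn_Icc
  -- (iii) near zero `[−rz, 0]`
  have hnear : IntegrableOn (fun x : ℝ ↦ D.phiKernel x) (Icc (-D.rz) 0) := by
    obtain ⟨C, hC, hB⟩ := D.exists_bound_near_zero
    rw [integrableOn_Icc_iff_integrableOn_Ioo]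
    have hg : IntegrableOn (fun x : ℝ ↦ C * (-x) ^ (-(1 / 3 : ℝ))) (Ioo (-D.rz) 0) := by
      have h1 := ((intervalIntegral.intervalIntegrable_rpow' (a := D.rz) (b := 0) (r := -(1 / 3 : ℝ))
        (by norm_num)).comp_sub_left 0).const_mul C
      have h2 := h1.def'
      simp only [zero_sub, sub_self] at h2
      rw [uIoc_of_le (by linarith : -D.rz ≤ 0)] at h2
      exact h2.mono_set Ioo_subset_Ioc_self
    refine hg.mono' ?_ ?_
    · exact (hcont.mono fun x hx ↦ hx.2).aestronglyMeasurable measurableSet_Ioo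
    · refine (ae_restrict_iff' measurableSet_Ioo).2 (ae_of_all _ fun x hx ↦ ?_)
      have hx0 : (x : ℂ) ≠ 0 := by exact_mod_cast hx.2.ne
      have hnorm : ‖(x : ℂ)‖ = -x := by
        rw [Complex.norm_real, Real.norm_eq_abs, abs_of_neg hx.2]
      have := hB (x : ℂ) hx0 (by rw [hnorm]; linarith [hx.1])
      rwa [hnorm] at this
  have h1 := htail.union hmid
  rw [Iic_union_Icc_eq_Iic (by linarith [D.rz_le_half] : (-4:ℝ) ≤ -D.rz)] at h1
  have h2 := h1.union hnear
  rwa [Iic_union_Icc_eq_Iic (by linarith : -D.rz ≤ 0)] at h2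

/-- `Φₑ(x) → Φ(∞)` as `x → −∞` along the real axis. [folklore] -/
theorem tendsto_phiExt_atBot : Tendsto (fun x : ℝ ↦ D.phiExt x) atBot (𝓝 D.phiInf) := by
  rw [tendsto_iff_norm_sub_tendsto_zero]
  have hbound : ∀ᶠ x : ℝ in atBot, ‖D.phiExt x - D.phiInf‖ ≤ 33 / |x| := by
    filter_upwards [eventually_le_atBot (-5 : ℝ)] with x hx
    have hnorm : ‖(x : ℂ)‖ = |x| := by rw [Complex.norm_real, Real.norm_eq_abs]
    have := D.norm_phiExt_sub_phiInf_le (w := (x : ℂ)) (by simp) (by rw [hnorm, abs_of_neg (by linarith)]; linarith)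
    rwa [hnorm] at this
  have hlim : Tendsto (fun x : ℝ ↦ 33 / |x|) atBot (𝓝 0) := tendsto_const_nhds.div_atTop tendsto_abs_atBot_atTop
  exact squeeze_zero_norm' (by filter_upwards [hbound] with x hx; rwa [norm_norm]) hlim

/-- **The apex identity** `∫_{−∞}^0 Φ'(x) dx = Φₑ(0) − Φ(∞)`. [folklore] -/
theorem integral_phiKernel_Iic : ∫ x in Iic (0:ℝ), D.phiKernel x = D.phiExt 0 - D.phiInf := by
  have h := integral_Iic_of_hasDerivAt_of_tendsto (f := fun x : ℝ ↦ D.phiExt x) (a := 0)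
    D.continuous_phiExt_ofReal.continuousWithinAt
    (fun x hx ↦ D.hasDerivAt_phiExt_real (D.ofReal_mem_kernelDomain_of_neg hx))
    D.integrableOn_phiKernel_Iic D.tendsto_phiExt_atBot
  simpa using h

end TestIntervals

end Literature.Probability.RandomPlanarGeometry
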